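import Summits.PneNP.PneNP.Theorems.NegLimitedDoorPlantedTransfer
import Summits.PneNP.PneNP.Theorems.NegLimitedDoorThresholdCircuits
import Literature.Computability.Complexity.RossmanMonotoneCliqueGraphs

/-!
# Route NegLimited — counting lemmas for the tightness of the door crux at `ε = 1/2` (stmt-PneNP-19860)

Helper file for the door item `NegLimited.NeglimitedEpsLogNegationsR` (stmt-PneNP-19860, line
`correlation-door`, ROUND-8 §B.2 test (4)(b)); the tightness theorems themselves are in
`NegLimitedDoorAdvantageTightness.lean`.  Contents: (A) the uniform measure on the cube
`ι → Bool` — the one-coordinate flip involution, `2·#{x | x_i = 0} = 2^N`, the second moment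
`Σ_x (2·wt(x) - N)² = N·2^N` and the resulting Chebyshev count for the window `|2·wt(x) - N| ≤ 2t`;
(B) graphs — planting `K_A` moves the edge count by the number `Z_A(x)` of absent pairs inside `A`
(`wt_plantClique`), `2·Σ_x Z_A(x) = C(|A|,2)·2^N`, the flip event of the edge-count threshold
`Thr_θ`, the window `W = [(N-2t)/2, (N+2t)/2 + K]`, and the averaging inequality
`C(m,k)·K·2^N ≤ 4·Σ_{θ ∈ W} flipCount θ` with its pigeonhole consequence.
References: B. Rossman, *Correlation bounds against monotone NC¹*, CCC 2015, §1 [Rossman2015]. -/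

set_option linter.dupNamespace false -- `Summit.PneNP.PneNP.…`: summit = sub-problem name (D-0017 single-conjunct layout)

noncomputable section

namespace Summit.PneNP.PneNP.Theorems.NegLimitedDoor.Tightness

open Finset Filter
open Literature.Computability.Complexity
open Summit.PneNP.PneNP.Theorems.NegLimitedDoor.Threshold

/-! ## Part A — the uniform measure on Boolean vectors: one-bit flips, Chebyshev for the weight -/

section Uniform

variable {ι : Type*}

/-- The `±1` version of a coordinate: `u_i(x) = 2[x_i] - 1`. [folklore] -/
def sgn (i : ι) (x : ι → Bool) : ℤ := if x i = true then 1 else -1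

/-- Diagonal terms: `u_i(x)² = 1`. [folklore] -/
theorem sgn_mul_self (i : ι) (x : ι → Bool) : sgn i x * sgn i x = 1 := by
  unfold sgn
  split_ifs <;> norm_num

/-- Flipping one coordinate (an involution of the cube). [folklore] -/
def flipAt [DecidableEq ι] (i : ι) (x : ι → Bool) : ι → Bool := Function.update x i (!x i)

/-- Flipping twice is the identity. [folklore] -/
theorem flipAt_flipAt [DecidableEq ι] (i : ι) (x : ι → Bool) : flipAt i (flipAt i x) = x := by
  funext j
  unfold flipAt
  by_cases h : j = i
  · subst h; simp
  · simp [Function.update_of_ne h]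

/-- The one-coordinate flip as a permutation of the cube. [folklore] -/
def flipEquiv [DecidableEq ι] (i : ι) : (ι → Bool) ≃ (ι → Bool) :=
  ⟨flipAt i, flipAt i, flipAt_flipAt i, flipAt_flipAt i⟩

/-- Flipping coordinate `i` negates `u_i`. [folklore] -/
theorem sgn_flipAt_self [DecidableEq ι] (i : ι) (x : ι → Bool) : sgn i (flipAt i x) = -sgn i x := by
  unfold sgn flipAt
  cases x i <;> simp

/-- Flipping coordinate `i` keeps `u_j`, `j ≠ i`. [folklore] -/
theorem sgn_flipAt_of_ne [DecidableEq ι] {i j : ι} (h : j ≠ i) (x : ι → Bool) :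
    sgn j (flipAt i x) = sgn j x := by
  unfold sgn flipAt
  rw [Function.update_of_ne h]

/-- Half of the cube has a given coordinate off: `2 · #{x | x_i = 0} = 2^N`. [folklore] -/
theorem two_mul_card_apply_eq_false [DecidableEq ι] [Fintype ι] (i : ι) :
    2 * #(univ.filter fun x : ι → Bool => x i = false) = 2 ^ Fintype.card ι := by
  have hbij : #(univ.filter fun x : ι → Bool => x i = true) =
      #(univ.filter fun x : ι → Bool => x i = false) := by
    refine card_bij (fun x _ => flipAt i x) (fun x hx => ?_) (fun x _ y _ h => ?_) (fun y hy => ?_)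
    · simp only [mem_filter, mem_univ, true_and] at hx ⊢
      simp [flipAt, hx]
    · have := congrArg (flipAt i) h
      rwa [flipAt_flipAt, flipAt_flipAt] at this
    · refine ⟨flipAt i y, ?_, flipAt_flipAt i y⟩
      simp only [mem_filter, mem_univ, true_and] at hy ⊢
      simp [flipAt, hy]
  have h := Finset.card_filter_add_card_filter_not (s := (univ : Finset (ι → Bool)))
    (fun x => x i = true)
  rw [card_univ, Fintype.card_fun, Fintype.card_bool] at h
  have h' : (univ.filter fun x : ι → Bool => ¬ x i = true) =
      univ.filter fun x : ι → Bool => x i = false :=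
    filter_congr fun x _ => by simp
  rw [h', hbij] at h
  omega

/-- Cross terms vanish: `Σ_x u_i(x) u_j(x) = 0` for `i ≠ j` (flip involution). [folklore] -/
theorem sum_sgn_mul_sgn_of_ne [DecidableEq ι] [Fintype ι] {i j : ι} (h : i ≠ j) :
    ∑ x : ι → Bool, sgn i x * sgn j x = 0 := by
  have hflip : ∑ x : ι → Bool, sgn i x * sgn j x =
      ∑ x : ι → Bool, sgn i (flipEquiv i x) * sgn j (flipEquiv i x) :=
    (Equiv.sum_comp (flipEquiv i) (fun x => sgn i x * sgn j x)).symm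
  have hneg : ∑ x : ι → Bool, sgn i (flipEquiv i x) * sgn j (flipEquiv i x) =
      -∑ x : ι → Bool, sgn i x * sgn j x := by
    rw [← sum_neg_distrib]
    refine sum_congr rfl fun x _ => ?_
    show sgn i (flipAt i x) * sgn j (flipAt i x) = -(sgn i x * sgn j x)
    rw [sgn_flipAt_self, sgn_flipAt_of_ne (Ne.symm h)]
    ring
  omega

/-- The centred weight is the sum of the `±1` coordinates: `2·wt(x) - N = Σ_i u_i(x)`. [folklore] -/
theorem two_mul_wt_sub_card [Fintype ι] (x : ι → Bool) :
    (2 * (wt x : ℤ) - Fintype.card ι) = ∑ i, sgn i x := by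
  unfold wt sgn
  rw [Finset.sum_ite, sum_const, sum_const, nsmul_eq_mul, nsmul_eq_mul, mul_one, mul_neg, mul_one]
  have h := Finset.card_filter_add_card_filter_not (s := (univ : Finset ι)) (fun i => x i = true)
  rw [card_univ] at h
  have : ((#(univ.filter fun i => ¬ x i = true) : ℕ) : ℤ) =
      (Fintype.card ι : ℤ) - #(univ.filter fun i => x i = true) := by
    omega
  rw [this]
  ring

/-- **The second moment of the weight under the uniform measure**:
`Σ_x (2·wt(x) - N)² = N · 2^N` (i.e. `Var[Bin(N, ½)] = N/4`). [folklore] -/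
theorem sum_sq_two_mul_wt_sub_card [DecidableEq ι] [Fintype ι] :
    ∑ x : ι → Bool, (2 * (wt x : ℤ) - Fintype.card ι) ^ 2 =
      (Fintype.card ι : ℤ) * 2 ^ Fintype.card ι := by
  have hcard : (Fintype.card (ι → Bool) : ℤ) = 2 ^ Fintype.card ι := by
    rw [Fintype.card_fun, Fintype.card_bool]; push_cast; rfl
  calc ∑ x : ι → Bool, (2 * (wt x : ℤ) - Fintype.card ι) ^ 2
      = ∑ x : ι → Bool, ∑ i, ∑ j, sgn i x * sgn j x := by
        refine sum_congr rfl fun x _ => ?_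
        rw [two_mul_wt_sub_card, sq, sum_mul_sum]
    _ = ∑ i : ι, ∑ j : ι, ∑ x : ι → Bool, sgn i x * sgn j x := by
        rw [sum_comm]
        exact sum_congr rfl fun i _ => sum_comm
    _ = ∑ i : ι, ∑ j : ι, (if i = j then (2 : ℤ) ^ Fintype.card ι else 0) := by
        refine sum_congr rfl fun i _ => sum_congr rfl fun j _ => ?_
        split_ifs with hij
        · subst hij
          simp only [sgn_mul_self, sum_const, card_univ, nsmul_eq_mul, mul_one]
          exact hcard
        · exact sum_sgn_mul_sgn_of_ne hij
    _ = (Fintype.card ι : ℤ) * 2 ^ Fintype.card ι := by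
        simp only [sum_ite_eq, mem_univ, if_true, sum_const, card_univ, nsmul_eq_mul]

/-- The concentration window of the weight, `|2·wt(x) - N| ≤ 2t`, as a Boolean test written without
subtraction. [folklore] -/
def inWin [Fintype ι] (t : ℕ) (x : ι → Bool) : Bool :=
  decide (Fintype.card ι ≤ 2 * wt x + 2 * t) && decide (2 * wt x ≤ Fintype.card ι + 2 * t)

/-- Unfolding the window test. [folklore] -/
theorem inWin_eq_true_iff [Fintype ι] {t : ℕ} {x : ι → Bool} :
    inWin t x = true ↔ Fintype.card ι ≤ 2 * wt x + 2 * t ∧ 2 * wt x ≤ Fintype.card ι + 2 * t := by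
  simp [inWin]

/-- **Chebyshev for the weight**: `4t² · #{x | |2·wt(x) - N| > 2t} ≤ N · 2^N`. [folklore] -/
theorem card_not_inWin_le [DecidableEq ι] [Fintype ι] (t : ℕ) :
    4 * (t : ℤ) ^ 2 * #(univ.filter fun x : ι → Bool => inWin t x = false) ≤
      (Fintype.card ι : ℤ) * 2 ^ Fintype.card ι := by
  rw [← sum_sq_two_mul_wt_sub_card]
  have hpt : ∀ x : ι → Bool, inWin t x = false →
      4 * (t : ℤ) ^ 2 ≤ (2 * (wt x : ℤ) - Fintype.card ι) ^ 2 := by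
    intro x hx
    have hx' : ¬ (Fintype.card ι ≤ 2 * wt x + 2 * t ∧ 2 * wt x ≤ Fintype.card ι + 2 * t) := by
      rw [← inWin_eq_true_iff, hx]; exact Bool.false_ne_true
    rw [not_and_or, not_le, not_le] at hx'
    rcases hx' with h | h
    · have h' : (2 * (wt x : ℤ) - Fintype.card ι) ≤ -(2 * t + 1) := by omega
      nlinarith
    · have h' : (2 * t + 1 : ℤ) ≤ 2 * (wt x : ℤ) - Fintype.card ι := by omega
      nlinarith
  calc 4 * (t : ℤ) ^ 2 * #(univ.filter fun x : ι → Bool => inWin t x = false)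
      = ∑ x ∈ univ.filter (fun x : ι → Bool => inWin t x = false), 4 * (t : ℤ) ^ 2 := by
        rw [sum_const, nsmul_eq_mul]; ring
    _ ≤ ∑ x ∈ univ.filter (fun x : ι → Bool => inWin t x = false),
          (2 * (wt x : ℤ) - Fintype.card ι) ^ 2 :=
        sum_le_sum fun x hx => hpt x (mem_filter.1 hx).2
    _ ≤ ∑ x : ι → Bool, (2 * (wt x : ℤ) - Fintype.card ι) ^ 2 :=
        sum_le_sum_of_subset_of_nonneg (filter_subset _ _) fun x _ _ => sq_nonneg _

end Uniform

/-! ## Part B — graphs: planting a clique moves the edge count by the absent pairs inside `A` -/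

section Graphs

variable {m : ℕ}

/-- The number of pairs inside `A` that are absent from the graph `x` (the jump of the edge count
under planting `K_A`). [folklore] -/
def absentIn (A : Finset (Fin m)) (x : ↥(⊤ : SimpleGraph (Fin m)).edgeSet → Bool) : ℕ :=
  #((univ.filter fun e : ↥(⊤ : SimpleGraph (Fin m)).edgeSet => cliqueVec A e = true).filter
    fun e => x e = false)

/-- At most `C(|A|, 2)` pairs are absent inside `A`. [folklore] -/
theorem absentIn_le (A : Finset (Fin m)) (x : ↥(⊤ : SimpleGraph (Fin m)).edgeSet → Bool) :
    absentIn A x ≤ (#A).choose 2 := by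
  unfold absentIn
  rw [← card_filter_cliqueVec A]
  exact card_le_card (filter_subset _ _)

/-- **Planting moves the edge count by the absent pairs**: `e(x ∪ K_A) = e(x) + Z_A(x)`. [folklore] -/
theorem wt_plantClique (A : Finset (Fin m)) (x : ↥(⊤ : SimpleGraph (Fin m)).edgeSet → Bool) :
    wt (plantClique A x) = wt x + absentIn A x := by
  unfold wt absentIn
  rw [filter_filter, ← card_union_of_disjoint]
  · congr 1
    ext e
    simp only [plantClique, mem_filter, mem_univ, true_and, mem_union, Bool.or_eq_true]
    constructor
    · rintro (h | h)
      · exact Or.inl h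
      · by_cases hx : x e = true
        · exact Or.inl hx
        · exact Or.inr ⟨h, by simpa using hx⟩
    · rintro (h | ⟨h, -⟩)
      · exact Or.inl h
      · exact Or.inr h
  · rw [disjoint_filter]
    intro e _ h1 h2
    rw [h2.2] at h1
    exact Bool.false_ne_true h1

/-- **Mean of the jump**: `2 · Σ_x Z_A(x) = C(|A|,2) · 2^N` (`E[Z_A] = K/2` under `G(m, ½)`).
[folklore] -/
theorem two_mul_sum_absentIn (A : Finset (Fin m)) :
    2 * ∑ x : ↥(⊤ : SimpleGraph (Fin m)).edgeSet → Bool, absentIn A x =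
      (#A).choose 2 * 2 ^ Fintype.card ↥(⊤ : SimpleGraph (Fin m)).edgeSet := by
  unfold absentIn
  simp_rw [card_filter]
  rw [sum_comm, mul_sum, ← card_filter_cliqueVec A, card_eq_sum_ones, sum_mul]
  refine sum_congr rfl fun e _ => ?_
  rw [one_mul, ← two_mul_card_apply_eq_false e, card_filter]

/-- **The flip event of the edge-count threshold**: `Thr_θ` is flipped by planting `K_A` into `x`
exactly when `e(x) < θ ≤ e(x) + Z_A(x)`. [folklore] -/
theorem thrFn_ne_thrFn_plantClique_iff (θ : ℕ) (A : Finset (Fin m))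
    (x : ↥(⊤ : SimpleGraph (Fin m)).edgeSet → Bool) :
    thrFn θ x ≠ thrFn θ (plantClique A x) ↔ wt x < θ ∧ θ ≤ wt x + absentIn A x := by
  unfold thrFn
  rw [wt_plantClique, ne_eq, Bool.eq_iff_iff, decide_eq_true_iff, decide_eq_true_iff]
  constructor
  · intro h
    by_cases h1 : θ ≤ wt x
    · exact absurd ⟨fun _ => h1.trans (Nat.le_add_right _ _), fun _ => h1⟩ h
    · refine ⟨by omega, ?_⟩
      by_contra h2
      exact h ⟨fun h' => absurd h' h1, fun h' => absurd h' h2⟩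
  · rintro ⟨h1, h2⟩ h
    have := h.2 h2
    omega

/-- The window of thresholds `W = [⌊(N - 2t)/2⌋, ⌊(N + 2t)/2⌋ + K]`. [folklore] -/
def window (N t K : ℕ) : Finset ℕ := Icc ((N - 2 * t) / 2) ((N + 2 * t) / 2 + K)

/-- The window is not empty. [folklore] -/
theorem window_nonempty (N t K : ℕ) : (window N t K).Nonempty := by
  unfold window
  exact nonempty_Icc.2 (by omega)

/-- The size of the window: `|W| ≤ 2t + K + 2`. [folklore] -/
theorem card_window_le (N t K : ℕ) : #(window N t K) ≤ 2 * t + K + 2 := by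
  unfold window
  rw [Nat.card_Icc]
  omega

/-- **All flipping thresholds of a concentrated graph lie in the window**: if
`|2e(x) - N| ≤ 2t` and `Z_A(x) ≤ K`, the `Z_A(x)` thresholds `e(x) < θ ≤ e(x) + Z_A(x)` are in
`W`. [folklore] -/
theorem absentIn_le_card_filter_window {N t K : ℕ} {A : Finset (Fin m)}
    {x : ↥(⊤ : SimpleGraph (Fin m)).edgeSet → Bool}
    (hN : Fintype.card ↥(⊤ : SimpleGraph (Fin m)).edgeSet = N) (hK : (#A).choose 2 ≤ K)
    (hx : inWin t x = true) :
    absentIn A x ≤ #((window N t K).filter fun θ => wt x < θ ∧ θ ≤ wt x + absentIn A x) := by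
  have hZ : absentIn A x ≤ K := (absentIn_le A x).trans hK
  rw [inWin_eq_true_iff, hN] at hx
  obtain ⟨h1, h2⟩ := hx
  calc absentIn A x = #(Icc (wt x + 1) (wt x + absentIn A x)) := by
        rw [Nat.card_Icc]; omega
    _ ≤ #((window N t K).filter fun θ => wt x < θ ∧ θ ≤ wt x + absentIn A x) := by
        refine card_le_card fun θ hθ => ?_
        rw [mem_Icc] at hθ
        simp only [window, mem_filter, mem_Icc]
        omega

/-- The flip count of the threshold `θ` against the planted `k`-cliques:
`Σ_A #{x | Thr_θ(x) ≠ Thr_θ(x ∪ K_A)}`. [folklore] -/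
def flipCount (m k θ : ℕ) : ℕ :=
  ∑ A ∈ powersetCard k (univ : Finset (Fin m)),
    #(univ.filter fun x : ↥(⊤ : SimpleGraph (Fin m)).edgeSet → Bool =>
      thrFn θ x ≠ thrFn θ (plantClique A x))

/-- **The averaging inequality**: summed over the window, the flip counts are at least
`C(m,k) · K · 2^N / 4` (`K = C(k,2)`, `N = C(m,2)`, `t² ≥ N`, `t ≥ 1`):
`Σ_θ Σ_A #flip ≥ Σ_A Σ_{x concentrated} Z_A(x) ≥ Σ_A (E-part K·2^N/2 - K·#{not concentrated})` and
Chebyshev. [folklore] -/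
theorem sum_window_flipCount_ge (m k t : ℕ) (ht : 1 ≤ t)
    (htN : Fintype.card ↥(⊤ : SimpleGraph (Fin m)).edgeSet ≤ t ^ 2) :
    (m.choose k) * (k.choose 2) * 2 ^ Fintype.card ↥(⊤ : SimpleGraph (Fin m)).edgeSet ≤
      4 * ∑ θ ∈ window (Fintype.card ↥(⊤ : SimpleGraph (Fin m)).edgeSet) t (k.choose 2),
        flipCount m k θ := by
  classical
  set N := Fintype.card ↥(⊤ : SimpleGraph (Fin m)).edgeSet with hN
  set K := k.choose 2 with hK
  set W := window N t K with hW
  -- Chebyshev: `4 B ≤ 2^N` for the number `B` of non-concentrated graphs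
  set B := #(univ.filter fun x : ↥(⊤ : SimpleGraph (Fin m)).edgeSet → Bool => inWin t x = false)
    with hB
  have hCheb : 4 * B ≤ 2 ^ N := by
    have h := card_not_inWin_le (ι := ↥(⊤ : SimpleGraph (Fin m)).edgeSet) t
    rw [← hN, ← hB] at h
    have ht2 : (0 : ℤ) < (t : ℤ) ^ 2 := by positivity
    have h' : 4 * (t : ℤ) ^ 2 * B ≤ (t : ℤ) ^ 2 * 2 ^ N := by
      refine h.trans ?_
      have : (N : ℤ) ≤ (t : ℤ) ^ 2 := by exact_mod_cast htN
      have h2 : (0 : ℤ) ≤ 2 ^ N := by positivity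
      nlinarith
    have h'' : (4 * B : ℤ) ≤ 2 ^ N := by nlinarith
    exact_mod_cast h''
  -- per planted set `A` with `#A = k`
  have hA : ∀ A ∈ powersetCard k (univ : Finset (Fin m)),
      K * 2 ^ N ≤ 4 * ∑ θ ∈ W, #(univ.filter fun x : ↥(⊤ : SimpleGraph (Fin m)).edgeSet → Bool =>
        thrFn θ x ≠ thrFn θ (plantClique A x)) := by
    intro A hAk
    have hcardA : #A = k := (mem_powersetCard.1 hAk).2
    -- swap the sums: `Σ_θ #{x | flip} = Σ_x #{θ ∈ W | flip}`
    have hswap : ∑ θ ∈ W, #(univ.filter fun x : ↥(⊤ : SimpleGraph (Fin m)).edgeSet → Bool =>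
        thrFn θ x ≠ thrFn θ (plantClique A x)) =
        ∑ x : ↥(⊤ : SimpleGraph (Fin m)).edgeSet → Bool,
          #(W.filter fun θ => wt x < θ ∧ θ ≤ wt x + absentIn A x) := by
      simp_rw [card_filter]
      rw [sum_comm]
      refine sum_congr rfl fun x _ => sum_congr rfl fun θ _ => ?_
      simp only [thrFn_ne_thrFn_plantClique_iff]
    rw [hswap]
    -- concentrated graphs contribute at least their jump
    have hlow : ∑ x : ↥(⊤ : SimpleGraph (Fin m)).edgeSet → Bool,
        (if inWin t x = true then absentIn A x else 0) ≤
        ∑ x : ↥(⊤ : SimpleGraph (Fin m)).edgeSet → Bool,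
          #(W.filter fun θ => wt x < θ ∧ θ ≤ wt x + absentIn A x) := by
      refine sum_le_sum fun x _ => ?_
      split_ifs with hx
      · exact absentIn_le_card_filter_window hN.symm (by rw [hcardA]) hx
      · exact Nat.zero_le _
    -- the non-concentrated graphs lose at most `K` each
    have hsplit : ∑ x : ↥(⊤ : SimpleGraph (Fin m)).edgeSet → Bool, absentIn A x ≤
        ∑ x : ↥(⊤ : SimpleGraph (Fin m)).edgeSet → Bool,
          (if inWin t x = true then absentIn A x else 0) + K * B := by
      have hpt : ∀ x : ↥(⊤ : SimpleGraph (Fin m)).edgeSet → Bool, absentIn A x ≤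
          (if inWin t x = true then absentIn A x else 0) +
            K * (if inWin t x = false then 1 else 0) := by
        intro x
        cases hx : inWin t x
        · simp only [Bool.false_eq_true, ↓reduceIte, mul_one, zero_add]
          rw [hK, ← hcardA]; exact absentIn_le A x
        · simp
      calc ∑ x : ↥(⊤ : SimpleGraph (Fin m)).edgeSet → Bool, absentIn A x
          ≤ ∑ x : ↥(⊤ : SimpleGraph (Fin m)).edgeSet → Bool,
              ((if inWin t x = true then absentIn A x else 0) +
                K * (if inWin t x = false then 1 else 0)) := sum_le_sum fun x _ => hpt x
        _ = _ := by
          rw [sum_add_distrib, ← mul_sum, hB, card_filter]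
    have hmean := two_mul_sum_absentIn A
    rw [hcardA, ← hK, ← hN] at hmean
    -- combine: 2·ΣZ = K·2^N, ΣZ ≤ Σ₁ + K·B, 4B ≤ 2^N, Σ₁ ≤ Σ_θ
    have hKB : 4 * (K * B) ≤ K * 2 ^ N := by
      calc 4 * (K * B) = K * (4 * B) := by ring
        _ ≤ K * 2 ^ N := Nat.mul_le_mul_left _ hCheb
    omega
  -- sum over `A`
  calc m.choose k * K * 2 ^ N = ∑ A ∈ powersetCard k (univ : Finset (Fin m)), K * 2 ^ N := by
        rw [sum_const, card_powersetCard, card_univ, Fintype.card_fin, smul_eq_mul, mul_assoc]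
    _ ≤ ∑ A ∈ powersetCard k (univ : Finset (Fin m)), 4 * ∑ θ ∈ W,
          #(univ.filter fun x : ↥(⊤ : SimpleGraph (Fin m)).edgeSet → Bool =>
            thrFn θ x ≠ thrFn θ (plantClique A x)) := sum_le_sum hA
    _ = 4 * ∑ θ ∈ W, flipCount m k θ := by
        rw [← mul_sum, sum_comm]
        rfl

/-- **Pigeonhole over the window**: some threshold `θ ∈ W` has
`4·|W|·flipCount θ ≥ C(m,k)·K·2^N`. [folklore] -/
theorem exists_threshold_flipCount_ge (m k t : ℕ) (ht : 1 ≤ t)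
    (htN : Fintype.card ↥(⊤ : SimpleGraph (Fin m)).edgeSet ≤ t ^ 2) :
    ∃ θ ∈ window (Fintype.card ↥(⊤ : SimpleGraph (Fin m)).edgeSet) t (k.choose 2),
      (m.choose k) * (k.choose 2) * 2 ^ Fintype.card ↥(⊤ : SimpleGraph (Fin m)).edgeSet ≤
        4 * #(window (Fintype.card ↥(⊤ : SimpleGraph (Fin m)).edgeSet) t (k.choose 2)) *
          flipCount m k θ := by
  set W := window (Fintype.card ↥(⊤ : SimpleGraph (Fin m)).edgeSet) t (k.choose 2) with hW
  have h := sum_window_flipCount_ge m k t ht htN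
  rw [← hW] at h
  refine exists_le_of_sum_le (window_nonempty _ _ _) ?_
  rw [sum_const, smul_eq_mul]
  calc #W * (m.choose k * k.choose 2 * 2 ^ Fintype.card ↥(⊤ : SimpleGraph (Fin m)).edgeSet)
      ≤ #W * (4 * ∑ θ ∈ W, flipCount m k θ) := Nat.mul_le_mul_left _ h
    _ = ∑ θ ∈ W, 4 * #W * flipCount m k θ := by rw [mul_sum, mul_sum]; exact sum_congr rfl fun _ _ => by ring

end Graphs

end Summit.PneNP.PneNP.Theorems.NegLimitedDoor.Tightness

end
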